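import Literature.MathematicalPhysics.QuantumFieldTheory.Balaban1983to89.B7Prop5WindowNumerics
import Literature.MathematicalPhysics.QuantumFieldTheory.Balaban1983to89.B9Eq3115KnitLetterYOnto

/-!
# `Balaban1983to89.B9Eq3115KnitLetterYNumerics` — T. Bałaban, *Propagators for lattice gauge theories in a background field*, Commun. Math. Phys. **99** (1985)
# 389–434 [Balaban1985BackgroundPropagators], p. 396 («we will need α₀ so small that O(1)Mα₀ is still a sufficiently small number») with [5] = *Averaging operations
# for lattice gauge theories*, CMP **98** (1985), Prop. 5 p. 42: **THE X-FREE NUMERICS OF THE KNIT-LETTER LAWS ARE INHABITED** — one `α₀′(d, L)` below any prescribed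
# bound satisfying `α₀′ ≤ α_Q(d+1,L)`, `C₀α₀′ ≤ ⅓`, `2α₀′, 4α₀′ ≤ c₂′`, `e^{3200(d+2)²(d+5)α₀′} < 2`, `K(d+1,L)·α₀′ < 1`, and a threshold `a₁ > 0` with
# `K_pl(a)·L⁴ < α₀′` for all `0 ≤ a ≤ a₁`, at every `(d+1, ℓ+1)`

statement-level skeleton of published theorems with citation tags; proofs where landed; nothing here is a claim about the Yang–Mills mass gap

WHY THIS FILE (cell `pub-ymgap`, node N06, seat `dag-n06-l` = bundle F7 rows 20–21, gen 36; director-ym №375 «R2-A»).  The knit-letter laws on the regime of record —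
(L4) `isRealOnQ_QknitY_reg335`, (L6) `isOntoOnQ_QknitY_reg335`, (L7) dag-n06-c's `isBddOnQ_QknitY_reg335`, (L8) `isNullOnQ_QknitY_reg335`, the bundle
`qLawsY_QknitY_reg335` (`B9Eq3115KnitLetterYRealReg335`) and the row-closeness `norm_QknitY_sub_R_QY_parBY_le` (`B9Eq3115KnitLetterYRowCloseness`) — display the SAME
x-free numerics on an auxiliary `α₀′`: `0 < α₀′ ≤ α_Q(d+1,L)` (or its consequences `C₀α₀′ ≤ ⅓`, `2α₀′ ≤ c₂′`, `4α₀′ ≤ c₂′`), `e^{4·800((d+1)+1)²((d+1)+4)α₀′} < 2`,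
`K(d+1,L)·α₀′ < 1`, and the plaquette threshold `K_pl(Mα₀)·L⁴ < α₀′` linking `α₀′` to the member's `Mα₀`.  dag-n06-d's certificate edition discharges them by ONE
witness; this file is that witness (the sequel of g34's `B7Prop5WindowNumerics`, whose `alpha0W` is capped here by `1∕(2K(d+1,L)+2)` so that `K·α₀′ < 1` holds
uniformly in `L`).

WHAT IS PROVED (sorry-free; 1 `def`).  `alphaKW d ℓ := min (alpha0W d ℓ) (1 ∕ (2·kCol(d+1)(ℓ+1) + 2))`; `alphaKW_pos ∕ _le_alpha0W ∕ _le_one`; the inequalities one by one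
(`hα3_knitW`, `hα2_knitW`, `hα4_knitW`, `hexp_knitW`, ★ `alphaKW_le_alphaQ`, ★ `kCol_mul_alphaKW_lt_one`); the plaquette threshold for any `0 < α ≤ 1`
(`plaq_lt_of_le`, `Kpl_mul_lt_of_le` — def-Y's `Kpl i` unfolded, `(kGeo i).L = ℓ+1`); ★★★ `knitWindow_inhabited_le` (∃ `α₀′ ≤ amax` and `a₁ > 0` with every
inequality, the threshold stated for EVERY k-level index `i` over `(d, ℓ)` — x-free).
HONEST SCOPE.  Elementary real-number inequalities; no statement about print beyond «α₀ sufficiently small» being inhabited; helper, count-neutral; N06 NOT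
discharged; nothing continuum ∕ OS ∕ mass gap ∕ Clay.  No `sorry`, no `axiom`, no `instance`, no `notation`.
-/

noncomputable section

namespace Literature.MathematicalPhysics.QuantumFieldTheory.Balaban1983to89.B9Eq3115KnitLetterYNumerics

open B7Prop2Explicit (C0 c2')
open B7Prop5WindowNumerics (alpha0W alpha0W_pos alpha0W_le_one_div hα3_b7W hα4_b7W hsmall_b7W bbW bbW_pos C0_succ)
open B9Eq316AveragingTransposeZd (alphaQ)
open B9Eq3115KnitLetterYOnto (kCol kCol_nonneg)
open B9C2FormBoxRegimeY (Kpl)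
open B6KLevelCensusIndexV1 (KIdx kGeo)

variable (d ℓ : ℕ)

/-- `5 ≤ d + 5`. [folklore] -/
private theorem hA5 : (5 : ℝ) ≤ (d : ℝ) + 5 := by have : (0 : ℝ) ≤ d := Nat.cast_nonneg d; linarith
/-- `1 ≤ ℓ + 1`. [folklore] -/
private theorem hL1 : (1 : ℝ) ≤ (ℓ : ℝ) + 1 := by have : (0 : ℝ) ≤ ℓ := Nat.cast_nonneg ℓ; linarith

/-- **THE KNIT WINDOW WITNESS** `α₀′(d, L) = min (alpha0W d ℓ) (1 ∕ (2K(d+1,L) + 2))` — g34's B7 witness capped so that `K(d+1,L)·α₀′ < 1`.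
[cite: Balaban1985Averaging, Proposition 5 p.42; Balaban1985BackgroundPropagators, p.396 («α₀ so small that O(1)Mα₀ is still sufficiently small»)] -/
def alphaKW : ℝ := min (alpha0W d ℓ) (1 / (2 * kCol (d + 1) (ℓ + 1) + 2))

/-- `0 < α₀′`. [cite: Balaban1985Averaging, Proposition 5 p.42, bookkeeping] -/
theorem alphaKW_pos : 0 < alphaKW d ℓ := by
  unfold alphaKW
  have := kCol_nonneg (d + 1) (ℓ + 1)
  exact lt_min (alpha0W_pos d ℓ) (by positivity)

/-- `α₀′ ≤ alpha0W`. [cite: Balaban1985Averaging, Proposition 5 p.42, bookkeeping] -/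
theorem alphaKW_le_alpha0W : alphaKW d ℓ ≤ alpha0W d ℓ := min_le_left _ _

/-- `α₀′ ≤ 1∕(2K + 2)`. [cite: Balaban1985Averaging, (147) p.40, bookkeeping] -/
theorem alphaKW_le_inv : alphaKW d ℓ ≤ 1 / (2 * kCol (d + 1) (ℓ + 1) + 2) := min_le_right _ _

/-- `α₀′ ≤ 1`. [cite: Balaban1985Averaging, Proposition 5 p.42, bookkeeping] -/
theorem alphaKW_le_one : alphaKW d ℓ ≤ 1 := by
  have hk := kCol_nonneg (d + 1) (ℓ + 1)
  have h := alphaKW_le_inv d ℓ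
  have h2 : 1 / (2 * kCol (d + 1) (ℓ + 1) + 2) ≤ 1 := by
    rw [div_le_one (by positivity)]; linarith
  exact h.trans h2

/-- (hα3) `C₀(d+1)·α₀′ ≤ ⅓`. [cite: Balaban1985Averaging, Proposition 4 p.38 (hypothesis `C₀α₀ ≤ ⅓`)] -/
theorem hα3_knitW : C0 (d + 1) * alphaKW d ℓ ≤ 1 / 3 := by
  have hC : 0 ≤ C0 (d + 1) := by rw [C0_succ]; positivity
  exact (mul_le_mul_of_nonneg_left (alphaKW_le_alpha0W d ℓ) hC).trans (hα3_b7W d ℓ)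

/-- (hα4) `4α₀′ ≤ c₂′(d+1, ℓ+1)`. [cite: Balaban1985Averaging, Proposition 5 p.42] -/
theorem hα4_knitW : 4 * alphaKW d ℓ ≤ c2' (d + 1) (ℓ + 1) := by
  have := alphaKW_le_alpha0W d ℓ; have := hα4_b7W d ℓ; linarith

/-- (hα2) `2α₀′ ≤ c₂′(d+1, ℓ+1)`. [cite: Balaban1985Averaging, Proposition 2 p.26] -/
theorem hα2_knitW : 2 * alphaKW d ℓ ≤ c2' (d + 1) (ℓ + 1) := by
  have := alphaKW_pos d ℓ; have := hα4_knitW d ℓ; linarith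

/-- (hexp) `e^{4·800((d+1)+1)²((d+1)+4)·α₀′} < 2` (g34's Prop.-4 factor `≤ 2` with its `b > 0`, monotonicity of `exp`). [cite: Balaban1985Averaging, Proposition 4 p.38, (131) p.37] -/
theorem hexp_knitW : Real.exp (4 * (800 * (((d + 1 : ℕ) : ℝ) + 1) ^ 2 * (((d + 1 : ℕ) : ℝ) + 4)) * alphaKW d ℓ) < 2 := by
  have hsm := hsmall_b7W d ℓ
  set X : ℝ := 4 * (800 * (((d + 1 : ℕ) : ℝ) + 1) ^ 2 * (((d + 1 : ℕ) : ℝ) + 4)) with hX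
  have hX0 : 0 ≤ X := by positivity
  have hy : 0 < 8 * (131072 * (((d + 1 : ℕ) : ℝ) + 1) ^ 2) * bbW d ℓ := by have := bbW_pos d ℓ; positivity
  have hmono : Real.exp (X * alphaKW d ℓ) ≤ Real.exp (X * alpha0W d ℓ) :=
    Real.exp_le_exp.2 (mul_le_mul_of_nonneg_left (alphaKW_le_alpha0W d ℓ) hX0)
  have hE0 : 0 < Real.exp (X * alpha0W d ℓ) := Real.exp_pos _
  have hlt : Real.exp (X * alpha0W d ℓ) < 2 := by
    have : Real.exp (X * alpha0W d ℓ) * 1 < Real.exp (X * alpha0W d ℓ) * (1 + 8 * (131072 * (((d + 1 : ℕ) : ℝ) + 1) ^ 2) * bbW d ℓ) :=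
      mul_lt_mul_of_pos_left (by linarith) hE0
    linarith
  exact lt_of_le_of_lt hmono hlt

/-- ★ `α₀′ ≤ α_Q(d+1, ℓ+1)` (the three windows of `B9Eq316AveragingTransposeZd.alphaQ`: `1∕(3C₀)`, `c₂′∕4`, `1∕(25600((d+1)+1)²((d+1)+4)L^{(d+1)+1})`).
[cite: Balaban1985Averaging, Proposition 5 p.42, (147) p.40] -/
theorem alphaKW_le_alphaQ : alphaKW d ℓ ≤ alphaQ (d + 1) (ℓ + 1) := by
  have hA := hA5 d; have hl := hL1 ℓ
  have hC : 0 < C0 (d + 1) := by rw [C0_succ]; positivity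
  have h3 := hα3_knitW d ℓ
  have h4 := hα4_knitW d ℓ
  unfold alphaQ
  refine le_min (le_min ?_ ?_) ?_
  · rw [le_div_iff₀ (by positivity)]; linarith
  · linarith
  · have e2 : (((d + 1 : ℕ) : ℝ) + 1) = (d : ℝ) + 2 := by push_cast; ring
    have e5 : (((d + 1 : ℕ) : ℝ) + 4) = (d : ℝ) + 5 := by push_cast; ring
    have eL : (((ℓ + 1 : ℕ) : ℝ)) = (ℓ : ℝ) + 1 := by push_cast; ring
    rw [e2, e5, eL, show d + 1 + 1 = d + 2 from rfl]
    refine (alphaKW_le_alpha0W d ℓ).trans (alpha0W_le_one_div d ℓ (by positivity) ?_)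
    have hP : (0 : ℝ) ≤ ((ℓ : ℝ) + 1) ^ (d + 2) := by positivity
    have h1 : 25600 * ((d : ℝ) + 2) ^ 2 * ((d : ℝ) + 5) ≤ 2 ^ 30 * ((d : ℝ) + 5) ^ 4 := by
      have hd2 : ((d : ℝ) + 2) ^ 2 ≤ ((d : ℝ) + 5) ^ 2 := by nlinarith
      nlinarith [pow_le_pow_left₀ (by norm_num : (0 : ℝ) ≤ 5) hA 2, mul_nonneg (by norm_num : (0 : ℝ) ≤ 25600) (sub_nonneg.2 hd2)]
    calc 25600 * ((d : ℝ) + 2) ^ 2 * ((d : ℝ) + 5) * ((ℓ : ℝ) + 1) ^ (d + 2)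
        ≤ 2 ^ 30 * ((d : ℝ) + 5) ^ 4 * ((ℓ : ℝ) + 1) ^ (d + 2) := mul_le_mul_of_nonneg_right h1 hP

/-- ★ `K(d+1, ℓ+1)·α₀′ < 1` (the onto threshold of `B9Eq3115KnitLetterYOnto`, uniformly in `L`). [cite: Balaban1985Averaging, (147) p.40; Balaban1985BackgroundPropagators, p.420] -/
theorem kCol_mul_alphaKW_lt_one : kCol (d + 1) (ℓ + 1) * alphaKW d ℓ < 1 := by
  have hk := kCol_nonneg (d + 1) (ℓ + 1)
  have h := alphaKW_le_inv d ℓ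
  have hpos : 0 < 2 * kCol (d + 1) (ℓ + 1) + 2 := by positivity
  calc kCol (d + 1) (ℓ + 1) * alphaKW d ℓ ≤ kCol (d + 1) (ℓ + 1) * (1 / (2 * kCol (d + 1) (ℓ + 1) + 2)) := mul_le_mul_of_nonneg_left h hk
    _ < 1 := by rw [← mul_div_assoc, mul_one, div_lt_one hpos]; linarith

/-- **THE PLAQUETTE THRESHOLD for any `0 < α ≤ 1`**: for `0 ≤ a ≤ α∕(128(ℓ+1)⁵)`, `2(10La)(1+10La)e^{40La}·L⁴ < α` (`L = ℓ+1`; g34's `hKa_b7W` with `alpha0W` replaced by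
any `α ≤ 1`). [cite: Balaban1985BackgroundPropagators, (3.35) p.396, (3.69) p.404] -/
theorem plaq_lt_of_le {α : ℝ} (hα : 0 < α) (hα1 : α ≤ 1) {a : ℝ} (ha : 0 ≤ a) (hale : a ≤ α / (128 * ((ℓ : ℝ) + 1) ^ 5)) :
    2 * (10 * ((ℓ : ℝ) + 1) * a) * (1 + 10 * ((ℓ : ℝ) + 1) * a) * Real.exp (4 * (10 * ((ℓ : ℝ) + 1) * a)) * ((ℓ : ℝ) + 1) ^ 4 < α := by
  have hl := hL1 ℓ
  set y : ℝ := 10 * ((ℓ : ℝ) + 1) * a with hy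
  have hy0 : 0 ≤ y := by rw [hy]; positivity
  have hL5 : (0 : ℝ) < ((ℓ : ℝ) + 1) ^ 5 := by positivity
  -- `y·L⁴ ≤ 10α∕128`
  have hyL : y * ((ℓ : ℝ) + 1) ^ 4 ≤ 10 * α / 128 := by
    rw [hy]
    calc 10 * ((ℓ : ℝ) + 1) * a * ((ℓ : ℝ) + 1) ^ 4 = 10 * (a * ((ℓ : ℝ) + 1) ^ 5) := by ring
      _ ≤ 10 * (α / (128 * ((ℓ : ℝ) + 1) ^ 5) * ((ℓ : ℝ) + 1) ^ 5) := by gcongr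
      _ = 10 * α / 128 := by field_simp
  have hy1 : y ≤ 1 / 8 := by
    have hL41 : (1 : ℝ) ≤ ((ℓ : ℝ) + 1) ^ 4 := one_le_pow₀ hl
    have : y ≤ y * ((ℓ : ℝ) + 1) ^ 4 := le_mul_of_one_le_right hy0 hL41
    linarith
  have hexp : Real.exp (4 * y) ≤ 1 + 2 * (4 * y) := by
    have habs : |4 * y| ≤ 1 := by rw [abs_of_nonneg (by positivity)]; linarith
    have h := Real.abs_exp_sub_one_le habs
    rw [abs_of_nonneg (by positivity : (0:ℝ) ≤ 4 * y)] at h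
    linarith [le_abs_self (Real.exp (4 * y) - 1)]
  calc 2 * y * (1 + y) * Real.exp (4 * y) * ((ℓ : ℝ) + 1) ^ 4 ≤ 2 * y * (1 + 1 / 8) * (1 + 2 * (4 * (1 / 8))) * ((ℓ : ℝ) + 1) ^ 4 := by
        gcongr
        calc Real.exp (4 * y) ≤ 1 + 2 * (4 * y) := hexp
          _ ≤ 1 + 2 * (4 * (1 / 8)) := by linarith
    _ = 9 / 2 * (y * ((ℓ : ℝ) + 1) ^ 4) := by ring
    _ ≤ 9 / 2 * (10 * α / 128) := by gcongr
    _ < α := by linarith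

variable {d ℓ}

/-- def-Y's plaquette constant at a k-level index over `(d, ℓ)`: `K_pl(a)·L⁴ < α` for `0 ≤ a ≤ α∕(128(ℓ+1)⁵)`, `0 < α ≤ 1` (`Kpl i` unfolded; `(kGeo i).L = ℓ + 1`).
[cite: Balaban1985BackgroundPropagators, (3.35) p.396, (3.69) p.404] -/
theorem Kpl_mul_lt_of_le {hd : 1 ≤ d + 1} {hL : Odd (ℓ + 1) ∧ 1 < ℓ + 1} {b₀ b₁ : ℝ} (i : KIdx d ℓ hd hL b₀ b₁) {α : ℝ} (hα : 0 < α) (hα1 : α ≤ 1)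
    {a : ℝ} (ha : 0 ≤ a) (hale : a ≤ α / (128 * ((ℓ : ℝ) + 1) ^ 5)) : Kpl i a * (kGeo i).L ^ 4 < α := by
  unfold Kpl
  rw [show (kGeo i).L = ((ℓ + 1 : ℕ) : ℝ) from rfl]
  push_cast
  exact plaq_lt_of_le ℓ hα hα1 ha hale

variable (d ℓ)

/-- ★★★ **THE X-FREE NUMERICS OF THE KNIT-LETTER LAWS ARE INHABITED, BELOW ANY PRESCRIBED `amax > 0`**: there are `α₀′ ∈ (0, amax]` and `a₁ > 0` with
`α₀′ ≤ α_Q(d+1,L)`, `C₀α₀′ ≤ ⅓`, `2α₀′ ≤ c₂′`, `4α₀′ ≤ c₂′`, `e^{4·800((d+1)+1)²((d+1)+4)α₀′} < 2`, `K(d+1,L)·α₀′ < 1`, and — for EVERY k-level index `i` over `(d, ℓ)` and every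
`0 ≤ a ≤ a₁` — `K_pl(a)·L⁴ < α₀′`, in BOTH spellings: unfolded `2(10La)(1+10La)e^{40La}·L⁴ < α₀′` (the certificate's `hKa`, `Kpl_mul_L4_eq`) and folded `Kpl i a * (kGeo i).L ^ 4 < α₀′`
(the `Mα₀`-threshold of the laws (L4) (L6) (L7) (L8), of the bundle `qLawsY_QknitY_reg335` and of the row-closeness `norm_QknitY_sub_R_QY_parBY_le`). [cite: Balaban1985Averaging, Proposition 5 p.42, (147) p.40; Balaban1985BackgroundPropagators, p.396, (3.35) p.396] -/
theorem knitWindow_inhabited_le {amax : ℝ} (hamax : 0 < amax) :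
    ∃ α₀' a₁ : ℝ, 0 < α₀' ∧ α₀' ≤ amax ∧ 0 < a₁ ∧
      α₀' ≤ alphaQ (d + 1) (ℓ + 1) ∧ C0 (d + 1) * α₀' ≤ 1 / 3 ∧ 2 * α₀' ≤ c2' (d + 1) (ℓ + 1) ∧ 4 * α₀' ≤ c2' (d + 1) (ℓ + 1) ∧
      Real.exp (4 * (800 * (((d + 1 : ℕ) : ℝ) + 1) ^ 2 * (((d + 1 : ℕ) : ℝ) + 4)) * α₀') < 2 ∧
      kCol (d + 1) (ℓ + 1) * α₀' < 1 ∧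
      (∀ a : ℝ, 0 ≤ a → a ≤ a₁ →
        2 * (10 * ((ℓ : ℝ) + 1) * a) * (1 + 10 * ((ℓ : ℝ) + 1) * a) * Real.exp (4 * (10 * ((ℓ : ℝ) + 1) * a)) * ((ℓ : ℝ) + 1) ^ 4 < α₀') ∧
      ∀ {hd : 1 ≤ d + 1} {hL : Odd (ℓ + 1) ∧ 1 < ℓ + 1} {b₀ b₁ : ℝ} (i : KIdx d ℓ hd hL b₀ b₁) (a : ℝ), 0 ≤ a → a ≤ a₁ → Kpl i a * (kGeo i).L ^ 4 < α₀' := by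
  have hl := hL1 ℓ
  set α : ℝ := min amax (alphaKW d ℓ) with hαdef
  have hα0 : 0 < α := lt_min hamax (alphaKW_pos d ℓ)
  have hαK : α ≤ alphaKW d ℓ := min_le_right _ _
  have hα1 : α ≤ 1 := hαK.trans (alphaKW_le_one d ℓ)
  have hC : 0 ≤ C0 (d + 1) := by rw [C0_succ]; positivity
  have hk := kCol_nonneg (d + 1) (ℓ + 1)
  have hX0 : 0 ≤ 4 * (800 * (((d + 1 : ℕ) : ℝ) + 1) ^ 2 * (((d + 1 : ℕ) : ℝ) + 4)) := by positivity
  refine ⟨α, α / (128 * ((ℓ : ℝ) + 1) ^ 5), hα0, min_le_left _ _, div_pos hα0 (by positivity),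
    hαK.trans (alphaKW_le_alphaQ d ℓ), ?_, ?_, ?_, ?_, ?_, fun a ha hale => plaq_lt_of_le ℓ hα0 hα1 ha hale,
    fun i a ha hale => Kpl_mul_lt_of_le i hα0 hα1 ha hale⟩
  · exact (mul_le_mul_of_nonneg_left hαK hC).trans (hα3_knitW d ℓ)
  · have := hα2_knitW d ℓ; linarith
  · have := hα4_knitW d ℓ; linarith
  · exact lt_of_le_of_lt (Real.exp_le_exp.2 (mul_le_mul_of_nonneg_left hαK hX0)) (hexp_knitW d ℓ)
  · exact lt_of_le_of_lt (mul_le_mul_of_nonneg_left hαK hk) (kCol_mul_alphaKW_lt_one d ℓ)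

end Literature.MathematicalPhysics.QuantumFieldTheory.Balaban1983to89.B9Eq3115KnitLetterYNumerics

end
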